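import Summits.ResolutionOfSingularities.ResolutionOfSingularities.Theorems.UltraWalkCert
import HarnessLib

/-!
# UltraWalkTransfer — the ŁOŚ TRANSFER: certified forced runs of every length give a forced WALK over the ultraproduct

NODE «UltraWalk» (decomp-res lens-3, gen 30), file 4/5 — THE TRANSLATION.  Data: a family of fields `K B`, states
`s₀ B` of degree `≤ d` which are roots of exponent `q = pᵉ`, and for every `B` a `β`-certified forced run `R B` of length
`B + 1` from `s₀ B`.  Along a free ultrafilter `U`:

* the level-`i` residual polynomials have supports in ONE degree box (`2^i · d`, `totalDegree_run_le`), so they are the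
  components of one polynomial `liftF R d i` over `Π_B K_B`; its image `Fs R d U i` over `K* = Π_U K_B` is the level-`i`
  polynomial UPSTAIRS; charts are `U`-a.e. constant (`chartLim`), points are classes of the level points (`ptUp`);
* the states `sts R d U i` defined by the tree's `step` from `⟨Fs 0, 0⟩` HAVE residual polynomial `Fs i` (`sts_F`: the
  `F`-component of `step` commutes with base change, then Łoś on the `U`-large set where level `B` is long enough and has
  the limiting chart);
* root, degree, `onExc`, equimultiplicity transfer as coefficient identities; the isolation CERTIFICATES of bounded size
  transfer (`certUp`: `U`-constant exponent, lifted multiplier and cofactors) and give `IsolatedTop` upstairs;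
* hence a `ForcedWalk (pᵉ) (sts 0)` over the perfect field `K*` (`walkUp`) and `¬ SliceTerminate d` (`not_sliceTerminate`).

No `sorry`, standard axioms. (Sources: Marker2002, Ex. 2.5.19–2.5.20; Hauser2010, §§F–G.) [folklore]
-/

noncomputable section

open MvPolynomial
open Literature.AlgebraicGeometry.Resolution
open Literature.AlgebraicGeometry.Resolution.Hauser2010
open Literature.AlgebraicGeometry.Resolution.PointBlowup
open Summit.ResolutionOfSingularities.ResolutionOfSingularities.Theorems.TightDefectClasses
open Summit.ResolutionOfSingularities.ResolutionOfSingularities.Theorems.UniformWalks (ForcedRun SliceTerminate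
  totalDegree_run_le)

namespace Summit.ResolutionOfSingularities.ResolutionOfSingularities.Theorems.UltraWalk

section Transfer

variable {β : ℕ → ℕ} {d p e : ℕ} {K : ℕ → Type} [∀ B, Field (K B)] [∀ B, DecidableEq (K B)]
  {s₀ : ∀ B, State (Fin 3) (K B)} (R : ∀ B, CertRun β (p ^ e) (s₀ B) (B + 1)) (d) (U : Ultrafilter ℕ)

/-! ## §1 Level data, boxed and lifted -/

/-- The level-`i` residual polynomial of run `B` (zero when the run is too short). DEFINITION (support). [folklore] -/
def levelF (i B : ℕ) : MvPolynomial (Fin 3) (K B) := if i ≤ B + 1 then ((R B).st i).F else 0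

omit U in
/-- The level polynomials at time `i` lie in the degree box `2^i · d`. [folklore] -/
theorem support_levelF (hdeg : ∀ B, (s₀ B).F.totalDegree ≤ d) (i B : ℕ) :
    (levelF R i B).support ⊆ dbox (Fin 3) (2 ^ i * d) := by
  unfold levelF
  split_ifs with h
  · exact support_subset_dbox ((totalDegree_run_le (R B).toForcedRun i h).trans (Nat.mul_le_mul_left _ (hdeg B)))
  · simp

/-- The lift of the level-`i` polynomials to the product ring. DEFINITION (support). [folklore] -/
def liftF (i : ℕ) : MvPolynomial (Fin 3) (∀ B, K B) := liftPoly (dbox (Fin 3) (2 ^ i * d)) (levelF R i)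

omit U in
/-- Its `B`-th component is the level polynomial of run `B` when the run is long enough. [folklore] -/
theorem map_ev_liftF (hdeg : ∀ B, (s₀ B).F.totalDegree ≤ d) {i B : ℕ} (h : i ≤ B + 1) :
    map (Pi.evalRingHom K B) (liftF R d i) = ((R B).st i).F := by
  rw [liftF, map_eval_liftPoly B (support_levelF R d hdeg i B), levelF, if_pos h]

/-- The level-`i` polynomial UPSTAIRS (over the ultraproduct). DEFINITION (support). [folklore] -/
def Fs (i : ℕ) : MvPolynomial (Fin 3) (Ultra K U) := map (Ultra.mk K U) (liftF R d i)

omit d in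
/-- The limiting chart at time `i` (charts are `U`-a.e. constant). DEFINITION (support). [folklore] -/
def chartLim (i : ℕ) : Fin 3 := Classical.choose (Ultrafilter.exists_eventually_eq_of_finite U fun B => (R B).j i)

omit d in
/-- The charts equal the limiting chart `U`-a.e. [folklore] -/
theorem chartLim_spec (i : ℕ) : ∀ᶠ B in (U : Filter ℕ), (R B).j i = chartLim R U i :=
  Classical.choose_spec (Ultrafilter.exists_eventually_eq_of_finite U fun B => (R B).j i)

omit d U in
/-- The level points at time `i`, as a point of the product ring. DEFINITION (support). [folklore] -/
def ptLift (i : ℕ) : Fin 3 → ∀ B, K B := fun l B => (R B).b i l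

omit d in
/-- The point UPSTAIRS at time `i`. DEFINITION (support). [folklore] -/
def ptUp (i : ℕ) : Fin 3 → Ultra K U := fun l => Ultra.mk K U (ptLift R i l)

omit d U in
/-- The `B`-th component of the lifted point is the level point. [folklore] -/
theorem ev_ptLift (i B : ℕ) : (fun l => Pi.evalRingHom K B (ptLift R i l)) = (R B).b i := rfl

/-- The states UPSTAIRS: the tree's `step` iterated from `⟨Fs 0, 0⟩` along the limiting charts and points.
DEFINITION (support). [folklore] -/
def sts [DecidableEq (Ultra K U)] : ℕ → State (Fin 3) (Ultra K U)
  | 0 => ⟨Fs R d U 0, 0⟩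
  | i + 1 => step (p ^ e) (chartLim R U i) (ptUp R U i) (sts i)

/-- The GOOD levels at time `i`: long enough and with the limiting chart — a set of the free ultrafilter. [folklore] -/
theorem good_eventually (hU : (U : Filter ℕ) ≤ Filter.cofinite) (i : ℕ) :
    ∀ᶠ B in (U : Filter ℕ), i ≤ B ∧ (R B).j i = chartLim R U i := by
  refine (Filter.Eventually.filter_mono hU ?_).and (chartLim_spec R U i)
  rw [Filter.eventually_cofinite]
  exact (Set.finite_lt_nat i).subset fun B hB => Nat.lt_of_not_le hB

/-! ## §2 The residual polynomials upstairs are the transferred ones -/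

/-- **`(sts i).F = Fs i`**: the `F`-component of `step` commutes with base change, then Łoś on the good levels. [folklore] -/
theorem sts_F [DecidableEq (Ultra K U)] (hU : (U : Filter ℕ) ≤ Filter.cofinite)
    (hdeg : ∀ B, (s₀ B).F.totalDegree ≤ d) : ∀ i, (sts R d U i).F = Fs R d U i := by
  intro i
  induction i with
  | zero => rfl
  | succ i ih =>
    rw [sts, step_F, ih, Fs, Fs]
    change deletePthPowers (p ^ e) (PointBlowup.translate (fun l => Ultra.mk K U (ptLift R i l))
      (chartTransform (p ^ e) (chartLim R U i) (map (Ultra.mk K U) (liftF R d i)))) = _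
    rw [← map_chartTransform, ← map_translate, ← map_deletePthPowers]
    apply map_mk_eq_of_eventually
    filter_upwards [good_eventually R U hU i] with B hB
    obtain ⟨hiB, hjB⟩ := hB
    rw [map_deletePthPowers, map_translate, map_chartTransform, map_ev_liftF R d hdeg (Nat.le_succ_of_le hiB),
      map_ev_liftF R d hdeg (Nat.succ_le_succ hiB), (R B).st_succ i (Nat.lt_succ_of_le hiB), step_F, hjB, ev_ptLift]

/-- The start upstairs is a ROOT of exponent `pᵉ` (Łoś for `deletePthPowers` and for `ord₀ ≥ pᵉ`). [folklore] -/
theorem isRoot_sts_zero [DecidableEq (Ultra K U)] (hdeg : ∀ B, (s₀ B).F.totalDegree ≤ d)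
    (hroot : ∀ B, IsRoot (p ^ e) (s₀ B)) : IsRoot (p ^ e) (sts R d U 0) := by
  refine ⟨rfl, ?_, ?_⟩
  · change deletePthPowers (p ^ e) (map (Ultra.mk K U) (liftF R d 0)) = map (Ultra.mk K U) (liftF R d 0)
    rw [← map_deletePthPowers]
    apply map_mk_eq_of_eventually
    filter_upwards with B
    rw [map_deletePthPowers, map_ev_liftF R d hdeg (Nat.zero_le _), (R B).st_zero]
    exact (hroot B).2.1
  · change (((p ^ e : ℕ)) : ℕ∞) ≤ ordZero (map (Ultra.mk K U) (liftF R d 0))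
    apply natCast_le_ordZero_map_mk
    filter_upwards with B
    rw [map_ev_liftF R d hdeg (Nat.zero_le _), (R B).st_zero]
    exact (hroot B).2.2

/-- The start upstairs has degree `≤ d`. [folklore] -/
theorem totalDegree_sts_zero [DecidableEq (Ultra K U)] : (sts R d U 0).F.totalDegree ≤ d := by
  change (map (Ultra.mk K U) (liftF R d 0)).totalDegree ≤ d
  have h := totalDegree_map_le_of_support_subset_dbox (Ultra.mk K U)
    (support_liftPoly_subset (dbox (Fin 3) (2 ^ 0 * d)) (levelF R 0))
  simpa [liftF] using h

/-- The points upstairs lie ON the exceptional component (Łoś for `b (j) = 0`). [folklore] -/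
theorem onExc_up (hU : (U : Filter ℕ) ≤ Filter.cofinite) (i : ℕ) : ptUp R U i (chartLim R U i) = 0 := by
  rw [ptUp, Ultra.mk_eq_zero_iff]
  filter_upwards [good_eventually R U hU i] with B hB
  obtain ⟨hiB, hjB⟩ := hB
  rw [ptLift, ← hjB]
  exact (R B).onExc i (Nat.lt_succ_of_le hiB)

/-- The points upstairs are EQUIMULTIPLE (Łoś for the vanishing of the low coefficients of the point transform). [folklore] -/
theorem equimult_up [DecidableEq (Ultra K U)] (hU : (U : Filter ℕ) ≤ Filter.cofinite)
    (hdeg : ∀ B, (s₀ B).F.totalDegree ≤ d) (i : ℕ) :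
    IsEquimultiplePoint (p ^ e) (chartLim R U i) (ptUp R U i) (sts R d U i) := by
  intro m hm hmq
  change coeff m (PointBlowup.translate (fun l => Ultra.mk K U (ptLift R i l))
    (chartTransform (p ^ e) (chartLim R U i) (sts R d U i).F)) = 0
  rw [sts_F R d U hU hdeg i, Fs, ← map_chartTransform, ← map_translate, coeff_map_mk_eq_zero_iff]
  filter_upwards [good_eventually R U hU i] with B hB
  obtain ⟨hiB, hjB⟩ := hB
  rw [map_translate, map_chartTransform, map_ev_liftF R d hdeg (Nat.le_succ_of_le hiB), ← hjB, ev_ptLift]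
  exact (R B).equimult i (Nat.lt_succ_of_le hiB) m hm hmq

/-! ## §3 Transfer of the isolation certificates -/

omit d U in
/-- The chosen certificate of run `B` at time `i < B + 1`. DEFINITION (support). [folklore] -/
def lc (i B : ℕ) (h : i < B + 1) : CertData (p ^ e) (β i) ((R B).st i).F := Classical.choice ((R B).cert i h)

omit d U in
/-- The level exponents (junk `0`). DEFINITION (support). [folklore] -/
def cN (i B : ℕ) : ℕ := if h : i < B + 1 then (lc R i B h).N else 0

omit d U in
/-- The level multipliers (junk `1`). DEFINITION (support). [folklore] -/
def cg (i B : ℕ) : MvPolynomial (Fin 3) (K B) := if h : i < B + 1 then (lc R i B h).g else 1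

omit d U in
/-- The level cofactors (junk `0`). DEFINITION (support). [folklore] -/
def ch (i : ℕ) (l : Fin 3) (a : Fin 3 →₀ ℕ) (B : ℕ) : MvPolynomial (Fin 3) (K B) :=
  if h : i < B + 1 then (lc R i B h).h l a else 0

omit d U in
/-- Level exponents are bounded by the certificate size. [folklore] -/
theorem cN_le (i B : ℕ) : cN R i B ≤ β i := by
  unfold cN; split_ifs with h
  · exact (lc R i B h).N_le
  · exact Nat.zero_le _

omit d U in
/-- Level multipliers have bounded degree. [folklore] -/
theorem cg_deg (i B : ℕ) : (cg R i B).totalDegree ≤ β i := by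
  unfold cg; split_ifs with h
  · exact (lc R i B h).g_deg
  · simp

omit d U in
/-- Level multipliers do not vanish at the origin. [folklore] -/
theorem cg_zero (i B : ℕ) : coeff 0 (cg R i B) ≠ 0 := by
  unfold cg; split_ifs with h
  · exact (lc R i B h).g_zero
  · simp

omit d U in
/-- Level cofactors have bounded degree. [folklore] -/
theorem ch_deg (i : ℕ) (l : Fin 3) (a : Fin 3 →₀ ℕ) (B : ℕ) : (ch R i l a B).totalDegree ≤ β i := by
  unfold ch; split_ifs with h
  · exact (lc R i B h).h_deg l a
  · simp

omit d U in
/-- On a long-enough level the certificate identity holds for the level data. [folklore] -/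
theorem level_eq {i B : ℕ} (h : i < B + 1) (l : Fin 3) :
    cg R i B * X l ^ cN R i B = ∑ a ∈ hasseIndex (Fin 3) (p ^ e), ch R i l a B * hasseDeriv (K B) a ((R B).st i).F := by
  simp only [cg, cN, ch, dif_pos h]
  exact (lc R i B h).eq l

/-- **The certificate UPSTAIRS** at time `i`: `U`-constant exponent, lifted multiplier and cofactors; the identity holds by
Łoś on the good levels (the Hasse derivatives commute with base change). [folklore] -/
def certUp (hU : (U : Filter ℕ) ≤ Filter.cofinite) (hdeg : ∀ B, (s₀ B).F.totalDegree ≤ d) (i : ℕ) :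
    CertData (p ^ e) (β i) (Fs R d U i) :=
  let hN := Ultrafilter.exists_eventually_eq_of_le U (cN_le R i)
  { N := Classical.choose hN
    N_le := (Classical.choose_spec hN).1
    g := map (Ultra.mk K U) (liftPoly (dbox (Fin 3) (β i)) (cg R i))
    g_deg := totalDegree_map_le_of_support_subset_dbox _ (support_liftPoly_subset _ _)
    g_zero := by
      rw [coeff_map_mk_ne_zero_iff]
      filter_upwards with B
      rw [map_eval_liftPoly B (support_subset_dbox (cg_deg R i B))]
      exact cg_zero R i B
    h := fun l a => map (Ultra.mk K U) (liftPoly (dbox (Fin 3) (β i)) (ch R i l a))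
    h_deg := fun l a => totalDegree_map_le_of_support_subset_dbox _ (support_liftPoly_subset _ _)
    eq := by
      intro l
      have hmul : MvPolynomial.map (Ultra.mk K U) (liftPoly (dbox (Fin 3) (β i)) (cg R i)) * X l ^ Classical.choose hN =
          MvPolynomial.map (Ultra.mk K U) (liftPoly (dbox (Fin 3) (β i)) (cg R i) * X l ^ Classical.choose hN) := by
        rw [map_mul, map_pow, map_X]
      have hsum : ∑ a ∈ hasseIndex (Fin 3) (p ^ e), MvPolynomial.map (Ultra.mk K U) (liftPoly (dbox (Fin 3) (β i))
            (ch R i l a)) * hasseDeriv (Ultra K U) a (Fs R d U i) = MvPolynomial.map (Ultra.mk K U)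
            (∑ a ∈ hasseIndex (Fin 3) (p ^ e), liftPoly (dbox (Fin 3) (β i)) (ch R i l a) * hasseDeriv _ a (liftF R d i)) := by
        rw [map_sum]
        refine Finset.sum_congr rfl fun a _ => ?_
        rw [map_mul, map_hasseDeriv, Fs]
      rw [hmul, hsum]
      apply map_mk_eq_of_eventually
      filter_upwards [good_eventually R U hU i, (Classical.choose_spec hN).2] with B hB hNB
      obtain ⟨hiB, -⟩ := hB
      have hlt : i < B + 1 := Nat.lt_succ_of_le hiB
      rw [map_mul, map_pow, map_X, map_eval_liftPoly B (support_subset_dbox (cg_deg R i B)), ← hNB, level_eq R hlt l,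
        map_sum]
      refine Finset.sum_congr rfl fun a _ => ?_
      rw [map_mul, map_hasseDeriv, map_eval_liftPoly B (support_subset_dbox (ch_deg R i l a B)),
        map_ev_liftF R d hdeg hlt.le] }

/-- Hence the origin upstairs is an ISOLATED top point at every time. [folklore] -/
theorem isolated_up [DecidableEq (Ultra K U)] (hU : (U : Filter ℕ) ≤ Filter.cofinite)
    (hdeg : ∀ B, (s₀ B).F.totalDegree ≤ d) (i : ℕ) : IsolatedTop (p ^ e) (sts R d U i).F := by
  rw [sts_F R d U hU hdeg i]
  exact isolatedTop_of_cert ⟨certUp R d U hU hdeg i⟩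

/-! ## §4 The forced walk upstairs -/

/-- **The FORCED WALK over the ultraproduct** assembled from certified runs of every length. [folklore] -/
def walkUp [DecidableEq (Ultra K U)] (hU : (U : Filter ℕ) ≤ Filter.cofinite) (hdeg : ∀ B, (s₀ B).F.totalDegree ≤ d) :
    ForcedWalk (p ^ e) (sts R d U 0) where
  j := chartLim R U
  b := ptUp R U
  st := sts R d U
  st_zero := rfl
  st_succ _ := rfl
  onExc i := onExc_up R U hU i
  equimult i := equimult_up R d U hU hdeg i
  isolated i := isolated_up R d U hU hdeg i

end Transfer

/-- **THE TRANSFER THEOREM.**  If for every `B` some root of exponent `pᵉ` and degree `≤ d` over some perfect field of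
characteristic `p` starts a `β`-certified forced run of length `B + 1`, then the degree slice `SliceTerminate d` FAILS:
the ultraproduct along a free ultrafilter carries an infinite forced walk. [folklore] -/
theorem not_sliceTerminate_of_certRuns {β : ℕ → ℕ} {d p e : ℕ} (hp : p.Prime) (he : 1 ≤ e) {K : ℕ → Type}
    [∀ B, Field (K B)] [∀ B, CharP (K B) p] [∀ B, PerfectField (K B)] [∀ B, DecidableEq (K B)]
    {s₀ : ∀ B, State (Fin 3) (K B)} (hroot : ∀ B, IsRoot (p ^ e) (s₀ B)) (hdeg : ∀ B, (s₀ B).F.totalDegree ≤ d)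
    (R : ∀ B, CertRun β (p ^ e) (s₀ B) (B + 1)) : ¬ SliceTerminate d := by
  classical
  intro hS
  haveI : Fact p.Prime := ⟨hp⟩
  haveI : CharP (Ultra K (Filter.hyperfilter ℕ)) p := Ultra.charP p
  haveI : PerfectField (Ultra K (Filter.hyperfilter ℕ)) := Ultra.perfectField p
  exact hS p hp e he (Ultra K (Filter.hyperfilter ℕ)) (sts R d (Filter.hyperfilter ℕ) 0)
    (isRoot_sts_zero R d _ hdeg hroot) (totalDegree_sts_zero R d _)
    (walkUp R d _ Filter.hyperfilter_le_cofinite hdeg)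

end Summit.ResolutionOfSingularities.ResolutionOfSingularities.Theorems.UltraWalk
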